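/-
Copyright (c) 2026 the pub-hodgecm-mathlib formalisation cell (harness21).  Prover seat hodgecm-mathlib-K2E1-p11 (g5), Track B ∕ K2-LIT, h413 = `stmt-HodgeConjecture-24833`,
R90-TF section S8 «ContSpec-n½», #2 road (G side) ∕ (V) road of socket B MID, S8 dealer R90-CS-plan (g3): (D1) THE NORM BOUND `hφM` OF THE WITNESS OF RECORD (g4's honest
NOT-DELIVERED item of 2026-09-05T01:10Z; census `R90/S8/CENSUS-ChiSectionPairNormBound.K2E1-p11-g5.md`).  For UNITARY `χ₁` and `|χ₂| = 1` the section of record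
`φ(g) = Φa(g_∞)·Φf(g_f)` (★ p863976) satisfies `‖φ‖ ≤ 1`: `|Φa| = 1` (`Φa = Θ(ℓ)·χ₂⟨det⟩` is a pure unitary phase) and `|Φf| ≤ 1` (`Φf = [χ₁χ₂](b_f)` on `B_f·K_f`, `0` off it).
-/
import Summits.HodgeConjecture.HodgeConjecture.Theorems.R90S8ChiSectionPairLevelOfRecordU3   -- ★ p863976 (this lineage, g4) 3d: `levelOfRecord`∕`omegaOfRecord` API, `isUnit_archLastRowL`, `archSectionE_mul_of_mem`, `archFin_mem_chiSectionSpacePair_levelOfRecord`; brings ★ 3c-E (`archSectionE_eq`, `continuous_archSectionE`, `archSectionE_one`), ★ 2b (`exists_finCongruenceLevel_borelPairChar_eq_one`), ★ 3b (`norm_lastRowChar_le_one`), ★ FILE 2 (`exists_finLevelSection`), ★ FILE 1 (`continuous_archFin`), ★ `chiSectionSpacePair_one`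
import HarnessLib

/-!
# S8 #2 road (G side) ∕ (V) row (i) — `R90S8ChiSectionPairNormBoundU3`: THE WITNESS OF RECORD IS BOUNDED BY `1` — the binder `hφM` (`Mφ := 1`)

Track B ∕ K2-LIT, crux h413 = `stmt-HodgeConjecture-24833`, route of record `HCCMUnconditional`; cell `hodgecm-mathlib`, R90-TF programme, section S8 «ContSpec-n½», socket B MID ∕ (V)
road, row (i) «non-zero continuous BOUNDED section at a level».  THEOREMS ONLY (no `def`, no `instance`, no `notation`, no named-fact hypothesis, no `sorry`; default heartbeats); lane
`--supports stmt-HodgeConjecture-24833 --as helper` (count-neutral).  CLOSES NO SOCKET.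

THE BINDER PAID.  ★ (V) OF RECORD ED. 1 `resGMidBlock_ne_bot_of_record` (K2E1-p15) and the ★ exports `chiPair_exports_of_witness` ∕ `midWitnessExports_spec` take the UNTWISTED witness section
`φ₀ ∈ chiSectionSpace χ K′ ω₀` with `(hφ₀c : Continuous φ₀) {Mφ : ℝ} (hφ₀M : ∀ x, ‖φ₀ x‖ ≤ Mφ)`.  The witness of record (★ p863976 `exists_level_mem_chiSectionSpacePair_levelOfRecord`) sits
behind an `∃`, so the bound has to be exported AS A CLAUSE of the witness theorem: this file re-issues the witness WITH the clause `∀ x, ‖φ x‖ ≤ 1`, under the unitarity letters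
`hχ₁u : χ₁.IsUnitary`, `hχ₂u : ∀ t, ‖χ₂ t‖ = 1` (VISIBLE; at the (V) block `χ₁ = ξ.bcη⁻¹·μω` is unitary by ★ `isUnitary_bcηInv_mul L ξ hμu`, and `χ₂ = 1`).

THE MATHEMATICS ([BorelJacquet1979, §4.1]; [MoeglinWaldspurger1995, I.2.17]; [Rogawski1990, §1.10]).  `φ(g) = Φa(g_∞)·Φf(g_f)` with `Φa = archSectionE χ₁ χ₂ = Θ(ℓ(a))·χ₂⟨det ι_∞ a⟩`
(★ `archSectionE_eq`: the Euclidean row factor `ρ_E ≡ 1`), `ℓ(a) ∈ 𝔸_Lˣ` (★ `isUnit_archLastRowL`), `Θ(X) = χ₁((c•X)⁻¹)·χ₂⟨(c•X)X⁻¹⟩` on units — so `|Φa| = |χ₁(·)|·|χ₂(·)|·|χ₂(·)| = 1`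
for unitary `χ₁, χ₂`.  The finite section of ★ FILE 2 is `[χ₁χ₂](b_f)` on `B_f·K_f` and `0` off it, hence `|Φf| ≤ 1`; formally we take ANY finite section `Φf` with the four exported
letters (★ `exists_finLevelSection`) and CLAMP it, `Φf′(u) := Φf(u)` if `‖Φf(u)‖ ≤ 1` and `0` otherwise: the Borel law `Φf(b_f u) = [χ₁χ₂](b_f)·Φf(u)` survives because
`‖[χ₁χ₂](b_f)‖ = 1` makes the clamp condition left-`B_f`-invariant, right-`K_f`-invariance survives verbatim and gives local constancy (hence continuity) on the open cosets `u·K_f`,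
`Φf′(1) = Φf(1) = 1`, and `‖Φf′‖ ≤ 1` by construction.  Then `‖φ(g)‖ = ‖Φa(g_∞)‖·‖Φf′(g_f)‖ ≤ 1`.  (★ p864054 `exists_norm_le_of_isChiSectionPair` (R90-C133-p02, same hour) bounds EVERY
continuous pair-section INEXPLICITLY under the same unitarity letters, by ★ CM Iwasawa + compactness of `K`; this file gives the EXPLICIT constant `Mφ = 1` for the witness of record
from its construction, Iwasawa-free, together with `|Φa| = 1`, the bounded finite section, and the character facts of `ω` that ED. 2 of the (V) OF RECORD binds.)
* §1 `norm_archSectionE_eq_one` (`|Φa| = 1`), `norm_archSectionE_le_one`.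
* §2 `exists_finLevelSection_norm_le` — ★ FILE 2's letters `hΦfc hΦfB hΦfK hΦf1` PLUS `∀ u, ‖Φf u‖ ≤ 1`.
* §3 `exists_mem_chiSectionSpacePair_levelOfRecord_norm_le` (at an open conductor level `K_f ≤ G(𝒪̂)_f`) and **`exists_level_mem_chiSectionSpacePair_levelOfRecord_norm_le (χ₁ χ₂ hχ₁u hχ₂u) :
  ∃ 𝔫 ≠ 0, ∃ φ, φ ∈ chiSectionSpacePair χ₁ χ₂ (levelOfRecord K(𝔫)_f) (omegaOfRecord χ₁ χ₂ K(𝔫)_f) ∧ Continuous φ ∧ φ 1 = 1 ∧ (∀ a, φ (ι a) = archSectionE χ₁ χ₂ a) ∧ ∀ x, ‖φ x‖ ≤ 1`**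
  (★ p863976's hypothesis-free head + the bound clause).
* §4 THE (V) ROW (i) CURRENCY (`χ₂ = 1`, ★ `chiSectionSpacePair_one`): **`exists_level_mem_chiSectionSpace_levelOfRecord_norm_le (χ) (hχu : χ.IsUnitary)`** — `hφ₀V hφ₀c hφ₀M` (`Mφ := 1`),
  `φ₀(1) = 1` and `φ₀ ∘ ι = archSectionE χ 1` in ONE `obtain`.
* §5 The right character of record is a unitary character of the level of record: `omegaOfRecord_one`, `omegaOfRecord_mul` (for ED. 2's `ω₀ : K′ →* ℂ`), `norm_omegaOfRecord_eq_one`.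
HONEST LABEL: HC_CM is proved only modulo the 7 printed citations (2 remaining named inputs: hLiu418 = `stmt-HodgeConjecture-24832`, h413 = `stmt-HodgeConjecture-24833`) until rung 0
closes; REL ≠ ★ ≠ BUILT; this file asserts no named fact and closes no socket — it pays the letter `hφM` of (V) row (i) at the witness of record, nothing else (`hVc`, `bV hbc hbM`, the
pole ledger, rows (ii)(iii)(i′) stay where S8-R192∕R197 put them); count-neutral.

## References
* [BorelJacquet1979] A. Borel, H. Jacquet, *Automorphic forms and automorphic representations*, Corvallis PSPM 33.1 (1979), §4.1.
* [MoeglinWaldspurger1995] C. Mœglin, J.-L. Waldspurger, *Spectral Decomposition and Eisenstein Series* (1995), I.2.17.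
* [Rogawski1990] J. D. Rogawski, *Automorphic Representations of Unitary Groups in Three Variables* (1990), §1.10.
-/

set_option autoImplicit false
set_option linter.dupNamespace false  -- the mandated namespace `…HodgeConjecture.HodgeConjecture.R90.S8` (LEAD #1 L1) repeats the summit's segment

noncomputable section

open NumberField IsDedekindDomain Topology Filter
open Literature.NumberTheory.Automorphic Literature.NumberTheory.Automorphic.UnitaryGroup Literature.NumberTheory.GaloisRepresentations AdelicGroupData
open Literature.NumberTheory.Automorphic.Arthur2013.Leaves.TECR
open Literature.NumberTheory.Automorphic.UnitaryGroup.AdelicCharactersDetQuasiSplit (antidiagonal_over_det_ne_zero)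
open Summit.HodgeConjecture.HodgeConjecture.Cruxes.H413.K2E1CharacterEisensteinU2Defs
open Summit.HodgeConjecture.HodgeConjecture.Cruxes.H413.K2E1CharacterEisensteinU3PairDefs
open Summit.HodgeConjecture.HodgeConjecture.Cruxes.H413.K2E1ChiSectionSpaceU2Defs (chiSectionSpace)
open Summit.HodgeConjecture.HodgeConjecture.Cruxes.H413.K2E1ChiSectionSpaceU3PairDefs

namespace Summit.HodgeConjecture.HodgeConjecture.R90.S8

variable (L : Type) [Field L] [NumberField L] [IsCMField L]

/-! ## §1 `|Φa| = 1`: the archimedean section of record is a pure unitary phase -/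

/-- **`‖Φa(a)‖ = 1` on `G_∞`** for unitary `χ₁` and `|χ₂| = 1`: `Φa = Θ(ℓ(a))·χ₂⟨det ι_∞ a⟩` (★ `archSectionE_eq`), `ℓ(a)` is an idele (★ `isUnit_archLastRowL`), and on ideles
`Θ(X) = χ₁((c•X)⁻¹)·χ₂⟨(c•X)X⁻¹⟩` has modulus `1`. [cite: Rogawski1990, §1.10] [cite: BorelJacquet1979, §4.1] -/
theorem norm_archSectionE_eq_one (χ₁ : HeckeCharacter L) (χ₂ : ↥(TorusDict.torus (IsCMField.complexConj L)) →ₜ* ℂˣ)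
    (hχ₁u : χ₁.IsUnitary) (hχ₂u : ∀ u, ‖((χ₂ u : ℂˣ) : ℂ)‖ = 1)
    (a : arch (↥(maximalRealSubfield L)) L (IsCMField.complexConj L) 3 ((StdForm.antidiagonal 3).over L)) : ‖archSectionE L χ₁ χ₂ a‖ = 1 := by
  rw [archSectionE_eq, norm_mul, lastRowChar_of_isUnit L χ₁ χ₂ (isUnit_archLastRowL L a), norm_mul, ← map_inv, hχ₁u _, adelicOneChar_apply, hχ₂u _,
    adelicOneChar_apply, hχ₂u _, mul_one, mul_one]

/-- **`‖Φa(a)‖ ≤ 1` on `G_∞`** for unitary `χ₁` and `|χ₂| = 1`. [cite: Rogawski1990, §1.10] -/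
theorem norm_archSectionE_le_one (χ₁ : HeckeCharacter L) (χ₂ : ↥(TorusDict.torus (IsCMField.complexConj L)) →ₜ* ℂˣ)
    (hχ₁u : χ₁.IsUnitary) (hχ₂u : ∀ u, ‖((χ₂ u : ℂˣ) : ℂ)‖ = 1)
    (a : arch (↥(maximalRealSubfield L)) L (IsCMField.complexConj L) 3 ((StdForm.antidiagonal 3).over L)) : ‖archSectionE L χ₁ χ₂ a‖ ≤ 1 :=
  (norm_archSectionE_eq_one L χ₁ χ₂ hχ₁u hχ₂u a).le

/-! ## §2 The finite level section WITH the bound `‖Φf‖ ≤ 1` -/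

/-- The finite Borel pair character has modulus `1` for unitary `χ₁` and `|χ₂| = 1`. [cite: MoeglinWaldspurger1995, I.2.17] -/
theorem norm_borelPairChar_fin_eq_one (χ₁ : HeckeCharacter L) (χ₂ : ↥(TorusDict.torus (IsCMField.complexConj L)) →ₜ* ℂˣ)
    (hχ₁u : χ₁.IsUnitary) (hχ₂u : ∀ u, ‖((χ₂ u : ℂˣ) : ℂ)‖ = 1)
    {b : (quasiSplit (↥(maximalRealSubfield L)) L (IsCMField.complexConj L) 3).Adelic} (hb : b ∈ borelAdelic (↥(maximalRealSubfield L)) L (IsCMField.complexConj L) 3) :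
    ‖((χ₁ (firstEntryUnit hb) : ℂˣ) : ℂ) * ((χ₂ (middleEntryUnitary hb) : ℂˣ) : ℂ)‖ = 1 := by
  rw [norm_mul, hχ₁u _, hχ₂u _, mul_one]

/-- **THE FINITE-ADELIC LEVEL SECTION, BOUNDED BY `1`**: for unitary `χ₁`, `|χ₂| = 1` and an OPEN `K_f ≤ G_f` on whose Borel elements the pair character is trivial (`hKχ`), there is
`Φf : G_f → ℂ` CONTINUOUS, LEFT-EQUIVARIANT `Φf(b_f·u) = [χ₁χ₂](b_f)·Φf(u)` for every adelic Borel `b`, RIGHT-`K_f`-INVARIANT, normalised `Φf 1 = 1`, AND `‖Φf u‖ ≤ 1` for all `u` — the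
letters `hΦfc hΦfB hΦfK hΦf1` of ★ FILE 2 `exists_finLevelSection` plus the bound: CLAMP any ★ finite section, `Φf′(u) := Φf(u)` if `‖Φf(u)‖ ≤ 1` and `0` otherwise (the clamp condition is
left-`B_f`-invariant because `‖[χ₁χ₂](b_f)‖ = 1`, and right-`K_f`-invariant; local constancy on the open cosets `u·K_f` gives continuity).
[cite: BorelJacquet1979, §4.1] [cite: MoeglinWaldspurger1995, I.2.17] -/
theorem exists_finLevelSection_norm_le (χ₁ : HeckeCharacter L) (χ₂ : ↥(TorusDict.torus (IsCMField.complexConj L)) →ₜ* ℂˣ)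
    (hχ₁u : χ₁.IsUnitary) (hχ₂u : ∀ u, ‖((χ₂ u : ℂˣ) : ℂ)‖ = 1)
    (Kf : Subgroup ↥(finAdelic (↥(maximalRealSubfield L)) L (IsCMField.complexConj L) 3 ((StdForm.antidiagonal 3).over L)))
    (hKo : IsOpen ((Kf : Subgroup ↥(finAdelic (↥(maximalRealSubfield L)) L (IsCMField.complexConj L) 3 ((StdForm.antidiagonal 3).over L))) : Set ↥(finAdelic (↥(maximalRealSubfield L)) L (IsCMField.complexConj L) 3 ((StdForm.antidiagonal 3).over L))))
    (hKχ : ∀ k ∈ Kf, ∀ (hk : finAdelicToAdelic (↥(maximalRealSubfield L)) L (IsCMField.complexConj L) 3 ((StdForm.antidiagonal 3).over L) k ∈ borelAdelic (↥(maximalRealSubfield L)) L (IsCMField.complexConj L) 3),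
      ((χ₁ (firstEntryUnit hk) : ℂˣ) : ℂ) * ((χ₂ (middleEntryUnitary hk) : ℂˣ) : ℂ) = 1) :
    ∃ Φf : ↥(finAdelic (↥(maximalRealSubfield L)) L (IsCMField.complexConj L) 3 ((StdForm.antidiagonal 3).over L)) → ℂ,
      Continuous Φf ∧
      (∀ (b : (quasiSplit (↥(maximalRealSubfield L)) L (IsCMField.complexConj L) 3).Adelic) (hb : b ∈ borelAdelic (↥(maximalRealSubfield L)) L (IsCMField.complexConj L) 3)
          (u : ↥(finAdelic (↥(maximalRealSubfield L)) L (IsCMField.complexConj L) 3 ((StdForm.antidiagonal 3).over L))),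
        Φf (finPart (↥(maximalRealSubfield L)) L (IsCMField.complexConj L) 3 ((StdForm.antidiagonal 3).over L) b * u) =
          (((χ₁ (firstEntryUnit (finAdelicToAdelic_finPart_mem_borelAdelic L hb)) : ℂˣ) : ℂ) * ((χ₂ (middleEntryUnitary (finAdelicToAdelic_finPart_mem_borelAdelic L hb)) : ℂˣ) : ℂ)) * Φf u) ∧
      (∀ u, ∀ k ∈ Kf, Φf (u * k) = Φf u) ∧ Φf 1 = 1 ∧ ∀ u, ‖Φf u‖ ≤ 1 := by
  classical
  obtain ⟨Φf, hΦfc, hΦfB, hΦfK, hΦf1⟩ := exists_finLevelSection L χ₁ χ₂ Kf hKo hKχ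
  -- the clamp `Φf′ := Φf · 𝟙{‖Φf‖ ≤ 1}`
  set Φf' : ↥(finAdelic (↥(maximalRealSubfield L)) L (IsCMField.complexConj L) 3 ((StdForm.antidiagonal 3).over L)) → ℂ := fun u => if ‖Φf u‖ ≤ 1 then Φf u else 0 with hΦf'
  have hK' : ∀ u, ∀ k ∈ Kf, Φf' (u * k) = Φf' u := fun u k hk => by
    simp only [hΦf', hΦfK u k hk]
  refine ⟨Φf', ?_, fun b hb u => ?_, hK', ?_, fun u => ?_⟩
  · -- continuity: `Φf′` is locally constant (constant on the open cosets `u·K_f`)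
    refine IsLocallyConstant.continuous ((IsLocallyConstant.iff_eventually_eq Φf').2 fun u => ?_)
    have hopen : IsOpen ((fun k => u * k) '' ((Kf : Subgroup ↥(finAdelic (↥(maximalRealSubfield L)) L (IsCMField.complexConj L) 3 ((StdForm.antidiagonal 3).over L))) :
        Set ↥(finAdelic (↥(maximalRealSubfield L)) L (IsCMField.complexConj L) 3 ((StdForm.antidiagonal 3).over L)))) := isOpenMap_mul_left u _ hKo
    filter_upwards [hopen.mem_nhds ⟨1, Kf.one_mem, mul_one u⟩] with y hy
    obtain ⟨k, hk, rfl⟩ := hy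
    exact hK' u k hk
  · -- the Borel law: the clamp condition is invariant since `‖[χ₁χ₂](b_f)‖ = 1`
    have hnorm : ‖Φf (finPart (↥(maximalRealSubfield L)) L (IsCMField.complexConj L) 3 ((StdForm.antidiagonal 3).over L) b * u)‖ = ‖Φf u‖ := by
      rw [hΦfB b hb u, norm_mul, norm_borelPairChar_fin_eq_one L χ₁ χ₂ hχ₁u hχ₂u (finAdelicToAdelic_finPart_mem_borelAdelic L hb), one_mul]
    by_cases h : ‖Φf u‖ ≤ 1
    · have h' : ‖Φf (finPart (↥(maximalRealSubfield L)) L (IsCMField.complexConj L) 3 ((StdForm.antidiagonal 3).over L) b * u)‖ ≤ 1 := hnorm ▸ h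
      simp only [hΦf', if_pos h, if_pos h']
      exact hΦfB b hb u
    · have h' : ¬ ‖Φf (finPart (↥(maximalRealSubfield L)) L (IsCMField.complexConj L) 3 ((StdForm.antidiagonal 3).over L) b * u)‖ ≤ 1 := hnorm ▸ h
      simp only [hΦf', if_neg h, if_neg h', mul_zero]
  · -- normalisation
    have h1 : ‖Φf 1‖ ≤ 1 := by rw [hΦf1, norm_one]
    simp only [hΦf', if_pos h1, hΦf1]
  · -- the bound
    by_cases h : ‖Φf u‖ ≤ 1
    · simp only [hΦf', if_pos h]; exact h
    · simp only [hΦf', if_neg h, norm_zero]; exact zero_le_one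

/-! ## §3 The witness of record WITH the bound `‖φ‖ ≤ 1` -/

/-- **THE WITNESS AT THE LEVEL OF RECORD, BOUNDED BY `1`** (★ p863976 `exists_mem_chiSectionSpacePair_levelOfRecord` + the bound clause): for unitary `χ₁`, `|χ₂| = 1` and an open
`K_f` on whose Borel elements the pair character dies there is `φ ∈ chiSectionSpacePair χ₁ χ₂ (levelOfRecord K_f) (omegaOfRecord χ₁ χ₂ K_f)`, continuous, `φ(1) = 1`, `φ ∘ ι = archSectionE χ₁ χ₂`,
with **`‖φ x‖ ≤ 1` for every `x`** (`φ(g) = Φa(g_∞)·Φf(g_f)`, §1 and §2). [cite: MoeglinWaldspurger1995, I.2.17] [cite: BorelJacquet1979, §4.1] [cite: Rogawski1990, §1.10] -/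
theorem exists_mem_chiSectionSpacePair_levelOfRecord_norm_le (χ₁ : HeckeCharacter L) (χ₂ : ↥(TorusDict.torus (IsCMField.complexConj L)) →ₜ* ℂˣ)
    (hχ₁u : χ₁.IsUnitary) (hχ₂u : ∀ u, ‖((χ₂ u : ℂˣ) : ℂ)‖ = 1)
    (Kf : Subgroup ↥(finAdelic (↥(maximalRealSubfield L)) L (IsCMField.complexConj L) 3 ((StdForm.antidiagonal 3).over L)))
    (hKo : IsOpen ((Kf : Subgroup ↥(finAdelic (↥(maximalRealSubfield L)) L (IsCMField.complexConj L) 3 ((StdForm.antidiagonal 3).over L))) :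
      Set ↥(finAdelic (↥(maximalRealSubfield L)) L (IsCMField.complexConj L) 3 ((StdForm.antidiagonal 3).over L))))
    (hKχ : ∀ k ∈ Kf, ∀ (hk : finAdelicToAdelic (↥(maximalRealSubfield L)) L (IsCMField.complexConj L) 3 ((StdForm.antidiagonal 3).over L) k ∈
        borelAdelic (↥(maximalRealSubfield L)) L (IsCMField.complexConj L) 3),
      ((χ₁ (firstEntryUnit hk) : ℂˣ) : ℂ) * ((χ₂ (middleEntryUnitary hk) : ℂˣ) : ℂ) = 1) :
    ∃ φ : (quasiSplit (↥(maximalRealSubfield L)) L (IsCMField.complexConj L) 3).Adelic → ℂ,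
      φ ∈ chiSectionSpacePair χ₁ χ₂ (levelOfRecord L Kf) (omegaOfRecord L χ₁ χ₂ Kf) ∧ Continuous φ ∧ φ 1 = 1 ∧
        (∀ a : arch (↥(maximalRealSubfield L)) L (IsCMField.complexConj L) 3 ((StdForm.antidiagonal 3).over L),
          φ (archToAdelic (↥(maximalRealSubfield L)) L (IsCMField.complexConj L) 3 ((StdForm.antidiagonal 3).over L) a) = archSectionE L χ₁ χ₂ a) ∧
        ∀ x, ‖φ x‖ ≤ 1 := by
  obtain ⟨Φf, hΦfc, hΦfB, hΦfK, hΦf1, hΦfM⟩ := exists_finLevelSection_norm_le L χ₁ χ₂ hχ₁u hχ₂u Kf hKo hKχ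
  refine ⟨_, archFin_mem_chiSectionSpacePair_levelOfRecord L χ₁ χ₂ Kf Φf hΦfB hΦfK, continuous_archFin L (archSectionE L χ₁ χ₂) Φf (continuous_archSectionE L χ₁ χ₂) hΦfc, ?_,
    fun a => ?_, fun x => ?_⟩
  · show archSectionE L χ₁ χ₂ (archPart (↥(maximalRealSubfield L)) L (IsCMField.complexConj L) 3 ((StdForm.antidiagonal 3).over L) 1) *
        Φf (finPart (↥(maximalRealSubfield L)) L (IsCMField.complexConj L) 3 ((StdForm.antidiagonal 3).over L) 1) = 1
    rw [map_one, map_one, archSectionE_one, hΦf1, mul_one]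
  · show archSectionE L χ₁ χ₂ (archPart (↥(maximalRealSubfield L)) L (IsCMField.complexConj L) 3 ((StdForm.antidiagonal 3).over L)
          (archToAdelic (↥(maximalRealSubfield L)) L (IsCMField.complexConj L) 3 ((StdForm.antidiagonal 3).over L) a)) *
        Φf (finPart (↥(maximalRealSubfield L)) L (IsCMField.complexConj L) 3 ((StdForm.antidiagonal 3).over L)
          (archToAdelic (↥(maximalRealSubfield L)) L (IsCMField.complexConj L) 3 ((StdForm.antidiagonal 3).over L) a)) = archSectionE L χ₁ χ₂ a
    rw [archPart_archToAdelic, finPart_archToAdelic, hΦf1, mul_one]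
  · show ‖archSectionE L χ₁ χ₂ (archPart (↥(maximalRealSubfield L)) L (IsCMField.complexConj L) 3 ((StdForm.antidiagonal 3).over L) x) *
        Φf (finPart (↥(maximalRealSubfield L)) L (IsCMField.complexConj L) 3 ((StdForm.antidiagonal 3).over L) x)‖ ≤ 1
    rw [norm_mul]
    exact mul_le_one₀ (norm_archSectionE_le_one L χ₁ χ₂ hχ₁u hχ₂u _) (norm_nonneg _) (hΦfM _)

/-- **THE WITNESS OF RECORD, BOUNDED BY `1`** (★ p863976 `exists_level_mem_chiSectionSpacePair_levelOfRecord` + the bound clause): for unitary `χ₁` and `|χ₂| = 1` there are a conductor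
level `𝔫 ≠ 0` (★ 2b) and `φ ∈ chiSectionSpacePair χ₁ χ₂ (levelOfRecord K(𝔫)_f) (omegaOfRecord χ₁ χ₂ K(𝔫)_f)`, continuous, `φ(1) = 1`, `φ ∘ ι = archSectionE χ₁ χ₂`, **`‖φ‖ ≤ 1`** — the
binders `hφV hφc hφM` (`Mφ := 1`) of the (V)(i) exports for the pair block. [cite: MoeglinWaldspurger1995, I.2.17] [cite: BorelJacquet1979, §4.1] [cite: Rogawski1990, §1.10] -/
theorem exists_level_mem_chiSectionSpacePair_levelOfRecord_norm_le (χ₁ : HeckeCharacter L) (χ₂ : ↥(TorusDict.torus (IsCMField.complexConj L)) →ₜ* ℂˣ)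
    (hχ₁u : χ₁.IsUnitary) (hχ₂u : ∀ u, ‖((χ₂ u : ℂˣ) : ℂ)‖ = 1) :
    ∃ 𝔫 : Ideal (𝓞 L), 𝔫 ≠ 0 ∧ ∃ φ : (quasiSplit (↥(maximalRealSubfield L)) L (IsCMField.complexConj L) 3).Adelic → ℂ,
      φ ∈ chiSectionSpacePair χ₁ χ₂ (levelOfRecord L (finCongruenceLevel (↥(maximalRealSubfield L)) L (IsCMField.complexConj L) 3 ((StdForm.antidiagonal 3).over L) 𝔫))
          (omegaOfRecord L χ₁ χ₂ (finCongruenceLevel (↥(maximalRealSubfield L)) L (IsCMField.complexConj L) 3 ((StdForm.antidiagonal 3).over L) 𝔫)) ∧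
        Continuous φ ∧ φ 1 = 1 ∧
          (∀ a : arch (↥(maximalRealSubfield L)) L (IsCMField.complexConj L) 3 ((StdForm.antidiagonal 3).over L),
            φ (archToAdelic (↥(maximalRealSubfield L)) L (IsCMField.complexConj L) 3 ((StdForm.antidiagonal 3).over L) a) = archSectionE L χ₁ χ₂ a) ∧
          ∀ x, ‖φ x‖ ≤ 1 := by
  obtain ⟨𝔫, h𝔫, h⟩ := exists_finCongruenceLevel_borelPairChar_eq_one L χ₁ χ₂
  exact ⟨𝔫, h𝔫, exists_mem_chiSectionSpacePair_levelOfRecord_norm_le L χ₁ χ₂ hχ₁u hχ₂u _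
    (isOpen_finCongruenceLevel (↥(maximalRealSubfield L)) L (IsCMField.complexConj L) 3 ((StdForm.antidiagonal 3).over L) h𝔫) h⟩

/-! ## §4 The (V) row (i) currency: `χ₂ = 1`, the single-character space `chiSectionSpace χ K′ ω` -/

/-- The trivial torus character has modulus `1`. [folklore] -/
theorem norm_one_torusChar_apply (u : ↥(TorusDict.torus (IsCMField.complexConj L))) :
    ‖(((1 : ↥(TorusDict.torus (IsCMField.complexConj L)) →ₜ* ℂˣ) u : ℂˣ) : ℂ)‖ = 1 := by
  rw [ContinuousMonoidHom.coe_one, Pi.one_apply, Units.val_one, norm_one]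

/-- **THE UNTWISTED WITNESS OF RECORD FOR (V) ROW (i), BOUNDED BY `1`**: for a UNITARY Hecke character `χ` there are a conductor level `𝔫 ≠ 0` and `φ₀ ∈ chiSectionSpace χ (levelOfRecord
K(𝔫)_f) (omegaOfRecord χ 1 K(𝔫)_f)` (★ `chiSectionSpacePair_one`: the pair space at `χ₂ = 1` IS the single-character space), continuous, `φ₀(1) = 1`, `φ₀ ∘ ι = archSectionE χ 1`, and
**`∀ x, ‖φ₀ x‖ ≤ 1`** — i.e. the binders `hφ₀V hφ₀c hφ₀M` (`Mφ := 1`) of ★ `resGMidBlock_ne_bot_of_record` ∕ ★ `midWitnessExports_spec` in one `obtain` (at the S8 block take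
`χ := ξ.bcη⁻¹ * μω`, unitary by ★ `isUnitary_bcηInv_mul L ξ hμu`). [cite: MoeglinWaldspurger1995, I.2.17] [cite: BorelJacquet1979, §4.1] [cite: Rogawski1990, §1.10] -/
theorem exists_level_mem_chiSectionSpace_levelOfRecord_norm_le (χ : HeckeCharacter L) (hχu : χ.IsUnitary) :
    ∃ 𝔫 : Ideal (𝓞 L), 𝔫 ≠ 0 ∧ ∃ φ : (quasiSplit (↥(maximalRealSubfield L)) L (IsCMField.complexConj L) 3).Adelic → ℂ,
      φ ∈ chiSectionSpace χ (levelOfRecord L (finCongruenceLevel (↥(maximalRealSubfield L)) L (IsCMField.complexConj L) 3 ((StdForm.antidiagonal 3).over L) 𝔫))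
          (omegaOfRecord L χ (1 : ↥(TorusDict.torus (IsCMField.complexConj L)) →ₜ* ℂˣ) (finCongruenceLevel (↥(maximalRealSubfield L)) L (IsCMField.complexConj L) 3 ((StdForm.antidiagonal 3).over L) 𝔫)) ∧
        Continuous φ ∧ φ 1 = 1 ∧
          (∀ a : arch (↥(maximalRealSubfield L)) L (IsCMField.complexConj L) 3 ((StdForm.antidiagonal 3).over L),
            φ (archToAdelic (↥(maximalRealSubfield L)) L (IsCMField.complexConj L) 3 ((StdForm.antidiagonal 3).over L) a) =
              archSectionE L χ (1 : ↥(TorusDict.torus (IsCMField.complexConj L)) →ₜ* ℂˣ) a) ∧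
          ∀ x, ‖φ x‖ ≤ 1 := by
  obtain ⟨𝔫, h𝔫, φ, hφV, hφc, hφ1, hφa, hφM⟩ :=
    exists_level_mem_chiSectionSpacePair_levelOfRecord_norm_le L χ (1 : ↥(TorusDict.torus (IsCMField.complexConj L)) →ₜ* ℂˣ) hχu (norm_one_torusChar_apply L)
  refine ⟨𝔫, h𝔫, φ, ?_, hφc, hφ1, hφa, hφM⟩
  rwa [chiSectionSpacePair_one] at hφV

/-! ## §5 The right character of record is a unitary character of the level of record -/

/-- **`ω(1) = 1`** for the right character of record (`ω(k) = Φa(k_∞)`, ★ `archSectionE_one`). [cite: BorelJacquet1979, §4.1] -/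
theorem omegaOfRecord_one (χ₁ : HeckeCharacter L) (χ₂ : ↥(TorusDict.torus (IsCMField.complexConj L)) →ₜ* ℂˣ)
    (Kf : Subgroup ↥(finAdelic (↥(maximalRealSubfield L)) L (IsCMField.complexConj L) 3 ((StdForm.antidiagonal 3).over L))) :
    omegaOfRecord L χ₁ χ₂ Kf 1 = 1 := by
  rw [omegaOfRecord_apply, OneMemClass.coe_one, map_one, archSectionE_one]

/-- **`ω(k·k′) = ω(k)·ω(k′)`** on the level of record: `(k k′)_∞ = k_∞ k′_∞` and `Φa(a·k′_∞) = Φa(a)·Φa(k′_∞)` for `ι(k′_∞) ∈ K` (★ 3d `archSectionE_mul_of_mem`, ★ `adelicVal_archToAdelic_archPart_mem`) —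
so ED. 2 of the (V) OF RECORD may bind `ω₀ := ⟨omegaOfRecord …, omegaOfRecord_one …, omegaOfRecord_mul …⟩ : K′ →* ℂ`. [cite: BorelJacquet1979, §4.1] [cite: Rogawski1990, §1.10] -/
theorem omegaOfRecord_mul (χ₁ : HeckeCharacter L) (χ₂ : ↥(TorusDict.torus (IsCMField.complexConj L)) →ₜ* ℂˣ)
    (Kf : Subgroup ↥(finAdelic (↥(maximalRealSubfield L)) L (IsCMField.complexConj L) 3 ((StdForm.antidiagonal 3).over L))) (k k' : ↥(levelOfRecord L Kf)) :
    omegaOfRecord L χ₁ χ₂ Kf (k * k') = omegaOfRecord L χ₁ χ₂ Kf k * omegaOfRecord L χ₁ χ₂ Kf k' := by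
  rw [omegaOfRecord_apply, omegaOfRecord_apply, omegaOfRecord_apply, Subgroup.coe_mul, map_mul]
  exact archSectionE_mul_of_mem L χ₁ χ₂ _ _ (adelicVal_archToAdelic_archPart_mem L ((mem_levelOfRecord_iff L Kf _).1 k'.2).1)

/-- **`‖ω(k)‖ = 1`** on the level of record for unitary `χ₁` and `|χ₂| = 1` (§1). [cite: BorelJacquet1979, §4.1] [cite: Rogawski1990, §1.10] -/
theorem norm_omegaOfRecord_eq_one (χ₁ : HeckeCharacter L) (χ₂ : ↥(TorusDict.torus (IsCMField.complexConj L)) →ₜ* ℂˣ)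
    (hχ₁u : χ₁.IsUnitary) (hχ₂u : ∀ u, ‖((χ₂ u : ℂˣ) : ℂ)‖ = 1)
    (Kf : Subgroup ↥(finAdelic (↥(maximalRealSubfield L)) L (IsCMField.complexConj L) 3 ((StdForm.antidiagonal 3).over L))) (k : ↥(levelOfRecord L Kf)) :
    ‖omegaOfRecord L χ₁ χ₂ Kf k‖ = 1 := by
  rw [omegaOfRecord_apply]
  exact norm_archSectionE_eq_one L χ₁ χ₂ hχ₁u hχ₂u _

end Summit.HodgeConjecture.HodgeConjecture.R90.S8

end
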